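import Mathlib
import Literature.NumberTheory.Sieve.MoebiusShiftedPrimesProofs
import HarnessLib

/-!
# Hardy–Littlewood–Chowla on average (Lichtman–Teräväinen 2022): averages of `(h/φ(h))^K` (Lemma 2.5)

Topic `Literature/NumberTheory/Sieve`, companion of `HardyLittlewoodChowla.lean` (the named facts
`lichtmanTeravainen2022_hlc_avg(_liouville)` = J. D. Lichtman, J. Teräväinen, *On the
Hardy–Littlewood–Chowla conjecture on average*, Forum Math. Sigma 10 (2022) e57,
doi:10.1017/fms.2022.54, arXiv:2111.08912 [LichtmanTeravainen2022], Theorem 1.2 (i)) and of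
`HardyLittlewoodChowlaSieve.lean` (Lemmas 2.3/2.4/2.11, whose singular-series factors
`∏ |s−s'|/φ(|s−s'|)` and `∏ |h−a|/φ(|h−a|)` are averaged here).  Everything in this file is
PROVED; it introduces no definition and no named fact.

**Lemma 2.5** of the paper (held copy `paper:arxiv-2111.08912`, p. 7): for fixed `C, k, r`,
`∑_{h ≤ H} ∏_{i ≤ r} (|Lᵢ(h)|/φ(|Lᵢ(h)|))^k ≪ H` uniformly over linear forms `Lᵢ(h) = aᵢh + bᵢ`
with `|aᵢ|, |bᵢ| ≤ C`, proved from the `m`-th moment bound (2.5) `∑_{h ≤ H'} (h/φ(h))^m ≪_m H'`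
and Hölder.  We prove (2.5) (`sum_pow_div_totient_le`, constant `exp(2^{K+1})`, by the expansion
`(d/φ(d))^K ≤ ∏_{p∣d}(1 + 2^{K+1}/p) = ∑_{S} ∏_{p∈S} 2^{K+1}/p`, exactly as the tree's
`Lichtman2020.sum_div_totient_le` does for `K = 1`) and the two instances of Lemma 2.5 which
Proposition 2.7 and §4 consume, for the weight `max(1, |z|/φ(|z|))` (`= |z|/φ(|z|)` for `z ≠ 0`,
`= 1` at `z = 0`, the harmless convention replacing the paper's "`0/φ(0) = 0`"):
`sum_weight_shift_le` (the form `u ↦ u + e`, any `e ∈ ℤ`: `≤ C (B + |e| + 1)`) and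
`sum_sum_weight_sub_le` (the form `(u, v) ↦ u − v + e` on a square).  In place of Hölder, products
of such weights are handled downstream by `prod_le_sum_pow_card`
(`∏_{i∈s} yᵢ ≤ ∑_{i∈s} yᵢ^{#s}` for `yᵢ ≥ 1`).

## References

* J. D. Lichtman, J. Teräväinen, Forum Math. Sigma 10 (2022) e57, arXiv:2111.08912, §2.2,
  Lemma 2.5 and display (2.5). [cite: LichtmanTeravainen2022, Lemma 2.5]
-/

noncomputable section

open Finset

namespace Literature.NumberTheory.Sieve

namespace LichtmanTeravainen2022

open Lichtman2020 (natCast_div_totient_eq_prod subset_primeFactors_iff_prod_dvd)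

/-! ### Lemma 2.5: `∑_{d ≤ N} (d/φ(d))^K ≪_K N` -/

/-- `(h/φ(h))^K ≤ ∏_{p ∣ h} (1 + 2^{K+1}/p)` for `h ≠ 0`: `h/φ(h) = ∏_{p∣h}(1 + 1/(p−1))`,
`(1 + 1/(p−1))^K ≤ 1 + (2^K−1)/(p−1) ≤ 1 + 2^{K+1}/p`. [cite: LichtmanTeravainen2022, Lemma 2.5 (proof)] -/
theorem pow_div_totient_le_prod {h : ℕ} (hh : h ≠ 0) (K : ℕ) :
    ((h : ℝ) / Nat.totient h) ^ K ≤ ∏ p ∈ h.primeFactors, (1 + 2 ^ (K + 1) / (p : ℝ)) := by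
  rw [natCast_div_totient_eq_prod hh, ← Finset.prod_pow]
  refine Finset.prod_le_prod (fun p hp => ?_) (fun p hp => ?_)
  · have h2 : (2 : ℝ) ≤ p := by exact_mod_cast (Nat.prime_of_mem_primeFactors hp).two_le
    have : (0 : ℝ) ≤ 1 / ((p : ℝ) - 1) := div_nonneg zero_le_one (by linarith)
    positivity
  · have h2 : (2 : ℝ) ≤ p := by exact_mod_cast (Nat.prime_of_mem_primeFactors hp).two_le
    have hp1 : 0 < (p : ℝ) - 1 := by linarith
    have hx0 : 0 ≤ 1 / ((p : ℝ) - 1) := by positivity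
    have hx1 : 1 / ((p : ℝ) - 1) ≤ 1 := by rw [div_le_one hp1]; linarith
    -- convexity: `(1 + x)^K ≤ 1 + (2^K - 1) x` on `[0, 1]`
    have conv : ∀ K : ℕ, (1 + 1 / ((p : ℝ) - 1)) ^ K ≤ 1 + (2 ^ K - 1) * (1 / ((p : ℝ) - 1)) := by
      intro K
      induction K with
      | zero => simp
      | succ K ih =>
        set x : ℝ := 1 / ((p : ℝ) - 1)
        have h2K : (1 : ℝ) ≤ 2 ^ K := one_le_pow₀ (by norm_num)
        calc (1 + x) ^ (K + 1) = (1 + x) * (1 + x) ^ K := by ring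
          _ ≤ (1 + x) * (1 + (2 ^ K - 1) * x) := mul_le_mul_of_nonneg_left ih (by linarith)
          _ = 1 + (2 ^ K - 1) * x + x + (2 ^ K - 1) * (x * x) := by ring
          _ ≤ 1 + (2 ^ K - 1) * x + x + (2 ^ K - 1) * x := by
              have : x * x ≤ x := by nlinarith
              nlinarith
          _ = 1 + (2 ^ (K + 1) - 1) * x := by ring
    refine (conv K).trans ?_
    have h2K : (1 : ℝ) ≤ 2 ^ K := one_le_pow₀ (by norm_num)
    -- `(2^K - 1)/(p-1) ≤ 2^{K+1}/p` since `p ≤ 2(p-1)`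
    have key : (2 ^ K - 1) * (1 / ((p : ℝ) - 1)) ≤ 2 ^ (K + 1) / (p : ℝ) := by
      rw [mul_one_div, div_le_div_iff₀ hp1 (by linarith), pow_succ]
      nlinarith
    linarith

/-- **Lichtman–Teräväinen, Lemma 2.5 (one form, `K`-th moment).**  For every `K` there is `C`
with `∑_{d=1}^{N} (d/φ(d))^K ≤ C N` for all `N` (printed: display (2.5),
`∑_{h ≤ H'} (h/φ(h))^m ≪_m H'`; here `C = exp(2^{K+1})`, by expanding
`(d/φ(d))^K ≤ ∑_{S ⊆ P(d)} ∏_{p ∈ S} 2^{K+1}/p`, swapping, `#{d ≤ N : ∏S ∣ d} ≤ N/∏S`, and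
`∏_p (1 + 2^{K+1}/p²) ≤ exp(2^{K+1} ∑ 1/(p(p−1))) ≤ exp(2^{K+1})`).
[cite: LichtmanTeravainen2022, Lemma 2.5, display (2.5)] -/
theorem sum_pow_div_totient_le (K : ℕ) : ∃ C : ℝ, 0 < C ∧ ∀ N : ℕ,
    ∑ d ∈ Icc 1 N, ((d : ℝ) / Nat.totient d) ^ K ≤ C * N := by
  refine ⟨Real.exp (2 ^ (K + 1)), Real.exp_pos _, fun N => ?_⟩
  set c : ℝ := 2 ^ (K + 1) with hc
  have hc0 : 0 ≤ c := by positivity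
  set P : Finset ℕ := Nat.primesLE N with hP
  set a : ℕ → ℝ := fun p => c / (p : ℝ) with ha
  set w : Finset ℕ → ℝ := fun S => ∏ p ∈ S, a p with hw
  have ha0 : ∀ p ∈ P, 0 ≤ a p := fun p hp => by simp only [ha]; positivity
  have hw0 : ∀ S ∈ P.powerset, 0 ≤ w S := fun S hS =>
    Finset.prod_nonneg fun p hp => ha0 p (Finset.mem_powerset.mp hS hp)
  have hpf : ∀ d ∈ Icc 1 N, d.primeFactors ⊆ P := by
    intro d hd p hp
    rw [Finset.mem_Icc] at hd
    rw [hP, Nat.mem_primesLE]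
    exact ⟨(Nat.le_of_mem_primeFactors hp).trans hd.2, Nat.prime_of_mem_primeFactors hp⟩
  -- Step 1: expand over subsets of `P`
  have h1 : ∀ d ∈ Icc 1 N, ((d : ℝ) / Nat.totient d) ^ K ≤
      ∑ S ∈ P.powerset, if S ⊆ d.primeFactors then w S else 0 := by
    intro d hd
    have hd0 : d ≠ 0 := by rw [Finset.mem_Icc] at hd; omega
    refine (pow_div_totient_le_prod hd0 K).trans (le_of_eq ?_)
    rw [Finset.prod_one_add, ← Finset.sum_filter]
    have hset : P.powerset.filter (fun S => S ⊆ d.primeFactors) = d.primeFactors.powerset := by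
      ext S
      simp only [Finset.mem_powerset, Finset.mem_filter]
      exact ⟨fun hS => hS.2, fun hS => ⟨hS.trans (hpf d hd), hS⟩⟩
    rw [hset]
  refine (Finset.sum_le_sum h1).trans ?_
  rw [Finset.sum_comm]
  -- Step 2: count the `d` for each `S`
  have h2 : ∀ S ∈ P.powerset,
      ∑ d ∈ Icc 1 N, (if S ⊆ d.primeFactors then w S else 0) ≤
        w S * ((N : ℝ) / ∏ p ∈ S, (p : ℝ)) := by
    intro S hS
    have hSp : ∀ p ∈ S, p.Prime := fun p hp =>
      (Nat.mem_primesLE.mp (Finset.mem_powerset.mp hS hp)).2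
    rw [← Finset.sum_filter, Finset.sum_const, nsmul_eq_mul, mul_comm]
    refine mul_le_mul_of_nonneg_left ?_ (hw0 S hS)
    have hcard : {d ∈ Icc 1 N | S ⊆ d.primeFactors} = {d ∈ Ioc 0 N | (∏ p ∈ S, p) ∣ d} := by
      ext d
      simp only [Finset.mem_filter, Finset.mem_Icc, Finset.mem_Ioc]
      constructor
      · rintro ⟨⟨hd1, hd2⟩, h3⟩
        exact ⟨⟨hd1, hd2⟩, (subset_primeFactors_iff_prod_dvd hSp (by omega)).mp h3⟩
      · rintro ⟨⟨hd1, hd2⟩, h3⟩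
        exact ⟨⟨hd1, hd2⟩, (subset_primeFactors_iff_prod_dvd hSp (by omega)).mpr h3⟩
    rw [hcard, Nat.Ioc_filter_dvd_card_eq_div]
    have hprod0 : (0 : ℝ) < ∏ p ∈ S, (p : ℝ) :=
      Finset.prod_pos fun p hp => by exact_mod_cast (hSp p hp).pos
    rw [le_div_iff₀ hprod0, ← Nat.cast_prod]
    exact_mod_cast Nat.div_mul_le_self N _
  refine (Finset.sum_le_sum h2).trans ?_
  -- Step 3: Euler product
  have h3 : ∑ S ∈ P.powerset, w S * ((N : ℝ) / ∏ p ∈ S, (p : ℝ)) =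
      N * ∏ p ∈ P, (1 + a p / p) := by
    rw [Finset.prod_one_add, Finset.mul_sum]
    refine Finset.sum_congr rfl fun S _ => ?_
    rw [hw, Finset.prod_div_distrib]
    ring
  rw [h3, mul_comm]
  refine mul_le_mul_of_nonneg_right ?_ (Nat.cast_nonneg _)
  calc ∏ p ∈ P, (1 + a p / p) ≤ ∏ p ∈ P, Real.exp (a p / p) := by
        refine Finset.prod_le_prod (fun p hp => by have := ha0 p hp; positivity) fun p hp => ?_
        linarith [Real.add_one_le_exp (a p / p)]
    _ = Real.exp (∑ p ∈ P, a p / p) := by rw [Real.exp_sum]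
    _ ≤ Real.exp (2 ^ (K + 1)) := by
        rw [Real.exp_le_exp]
        have h4 : ∀ p ∈ P, a p / p ≤ c * (1 / ((p : ℝ) * (p - 1))) := by
          intro p hp
          have h2 : (2 : ℝ) ≤ p := by exact_mod_cast (Nat.mem_primesLE.mp hp).2.two_le
          have hp0 : (0 : ℝ) < p := by linarith
          simp only [ha]
          rw [div_div, mul_one_div, div_le_div_iff₀ (by positivity) (by nlinarith)]
          nlinarith
        calc ∑ p ∈ P, a p / p ≤ ∑ p ∈ P, c * (1 / ((p : ℝ) * (p - 1))) := Finset.sum_le_sum h4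
          _ = c * ∑ p ∈ P, (1 / ((p : ℝ) * (p - 1))) := by rw [Finset.mul_sum]
          _ ≤ c * 1 := mul_le_mul_of_nonneg_left
              (Literature.NumberTheory.LFunctions.MertensBound.sum_inv_prime_mul_pred_le_one N) hc0
          _ = 2 ^ (K + 1) := by rw [hc, mul_one]

/-! ### Lemma 2.5 along a shifted variable -/

/-- **Lemma 2.5 for one linear form `u ↦ u + e`** (with the weight `max(1, ·)`, which is `1` at
`0` and `d/φ(d)` at `d ≠ 0`): `∑_{u=1}^{B} max(1, |u+e|/φ(|u+e|))^K ≤ C (B + |e| + 1)` — each value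
`d = |u + e| ≥ 1` is taken at most twice and is `≤ B + |e|`.
[cite: LichtmanTeravainen2022, Lemma 2.5] -/
theorem sum_weight_shift_le (K : ℕ) : ∃ C : ℝ, 0 < C ∧ ∀ (B : ℕ) (e : ℤ),
    ∑ u ∈ Icc 1 B, (max 1 ((((u : ℤ) + e).natAbs : ℝ) / Nat.totient ((u : ℤ) + e).natAbs)) ^ K ≤
      C * ((B : ℝ) + |(e : ℝ)| + 1) := by
  classical
  obtain ⟨C, hC, hsum⟩ := sum_pow_div_totient_le K
  refine ⟨2 * C + 1, by positivity, fun B e => ?_⟩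
  set f : ℕ → ℝ := fun d => ((d : ℝ) / Nat.totient d) ^ K with hf
  have hf0 : ∀ d, 0 ≤ f d := fun d => by positivity
  set g : ℕ → ℕ := fun u => ((u : ℤ) + e).natAbs with hg
  set N : ℕ := B + e.natAbs with hN
  -- split off the (at most one) `u` with `u + e = 0`
  set Z := (Icc 1 B).filter (fun u : ℕ => (u : ℤ) + e = 0) with hZ
  set R := (Icc 1 B).filter (fun u : ℕ => ¬ (u : ℤ) + e = 0) with hR
  have hsplit := (Finset.sum_filter_add_sum_filter_not (Icc 1 B) (fun u : ℕ => (u : ℤ) + e = 0)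
    (fun u : ℕ => (max 1 ((((u : ℤ) + e).natAbs : ℝ) / Nat.totient ((u : ℤ) + e).natAbs)) ^ K)).symm
  -- the zero part
  have hZcard : #Z ≤ 1 := by
    refine Finset.card_le_one.mpr fun a ha b hb => ?_
    rw [hZ, Finset.mem_filter] at ha hb
    have : (a : ℤ) = b := by linarith [ha.2, hb.2]
    exact_mod_cast this
  have hZsum : ∑ u ∈ Z, (max 1 ((((u : ℤ) + e).natAbs : ℝ) / Nat.totient ((u : ℤ) + e).natAbs)) ^ K
      ≤ 1 := by
    have h1 : ∀ u ∈ Z,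
        (max 1 ((((u : ℤ) + e).natAbs : ℝ) / Nat.totient ((u : ℤ) + e).natAbs)) ^ K = 1 := by
      intro u hu
      rw [hZ, Finset.mem_filter] at hu
      rw [hu.2]; simp
    rw [Finset.sum_congr rfl h1, Finset.sum_const, nsmul_eq_mul, mul_one]
    exact_mod_cast hZcard
  -- the nonzero part: values `d = |u+e| ∈ [1, N]`, each at most twice
  have hRterm : ∀ u ∈ R,
      (max 1 ((((u : ℤ) + e).natAbs : ℝ) / Nat.totient ((u : ℤ) + e).natAbs)) ^ K = f (g u) := by
    intro u hu
    rw [hR, Finset.mem_filter] at hu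
    have hne : ((u : ℤ) + e).natAbs ≠ 0 := by rw [Ne, Int.natAbs_eq_zero]; exact hu.2
    simp only [hf, hg]
    congr 1
    refine max_eq_right ?_
    rw [le_div_iff₀ (by exact_mod_cast Nat.totient_pos.mpr (Nat.pos_of_ne_zero hne)), one_mul]
    exact_mod_cast Nat.totient_le _
  have hRimg : R.image g ⊆ Icc 1 N := by
    intro d hd
    rw [Finset.mem_image] at hd
    obtain ⟨u, hu, rfl⟩ := hd
    rw [hR, Finset.mem_filter, Finset.mem_Icc] at hu
    rw [Finset.mem_Icc]
    constructor
    · exact Nat.pos_of_ne_zero (by rw [Ne, Int.natAbs_eq_zero]; exact hu.2)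
    · simp only [hg, hN]
      have : ((u : ℤ) + e).natAbs ≤ (u : ℤ).natAbs + e.natAbs := Int.natAbs_add_le _ _
      rw [Int.natAbs_natCast] at this
      omega
  have hfib : ∀ d ∈ R.image g, #(R.filter (fun u : ℕ => g u = d)) ≤ 2 := by
    intro d _
    have hsub : R.filter (fun u : ℕ => g u = d) ⊆
        ({((d : ℤ) - e).toNat, ((-(d : ℤ)) - e).toNat} : Finset ℕ) := by
      intro u hu
      rw [Finset.mem_filter] at hu
      have hgu := hu.2
      simp only [hg] at hgu
      rw [Finset.mem_insert, Finset.mem_singleton]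
      rcases Int.natAbs_eq ((u : ℤ) + e) with h | h <;> rw [hgu] at h
      · left
        have : (u : ℤ) = (d : ℤ) - e := by linarith
        rw [← this, Int.toNat_natCast]
      · right
        have : (u : ℤ) = -(d : ℤ) - e := by linarith
        rw [← this, Int.toNat_natCast]
    exact (Finset.card_le_card hsub).trans (Finset.card_le_two)
  have hRsum : ∑ u ∈ R, (max 1 ((((u : ℤ) + e).natAbs : ℝ) / Nat.totient ((u : ℤ) + e).natAbs)) ^ K
      ≤ 2 * (C * N) := by
    rw [Finset.sum_congr rfl hRterm, Finset.sum_comp]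
    calc ∑ d ∈ R.image g, #(R.filter (fun u : ℕ => g u = d)) • f d
        ≤ ∑ d ∈ R.image g, (2 : ℝ) * f d := by
          refine Finset.sum_le_sum fun d hd => ?_
          rw [nsmul_eq_mul]
          exact mul_le_mul_of_nonneg_right (by exact_mod_cast hfib d hd) (hf0 d)
      _ = 2 * ∑ d ∈ R.image g, f d := by rw [Finset.mul_sum]
      _ ≤ 2 * ∑ d ∈ Icc 1 N, f d := by
          refine mul_le_mul_of_nonneg_left ?_ (by norm_num)
          exact Finset.sum_le_sum_of_subset_of_nonneg hRimg fun d _ _ => hf0 d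
      _ ≤ 2 * (C * N) := mul_le_mul_of_nonneg_left (hsum N) (by norm_num)
  have hNe : (N : ℝ) = B + |(e : ℝ)| := by
    rw [hN]; push_cast; rw [Nat.cast_natAbs, Int.cast_abs]
  calc _ = _ := hsplit
    _ ≤ 1 + 2 * (C * N) := add_le_add hZsum hRsum
    _ = 1 + 2 * C * ((B : ℝ) + |(e : ℝ)|) := by rw [hNe]; ring
    _ ≤ (2 * C + 1) * ((B : ℝ) + |(e : ℝ)| + 1) := by
        have : 0 ≤ (B : ℝ) + |(e : ℝ)| := by positivity
        nlinarith

/-- **Lemma 2.5 for the form `(u, v) ↦ u − v + e` on a square**: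
`∑_{u,v=1}^{B} max(1, |u−v+e|/φ(|u−v+e|))^K ≤ C B (2B + |e| + 1)`.
[cite: LichtmanTeravainen2022, Lemma 2.5] -/
theorem sum_sum_weight_sub_le (K : ℕ) : ∃ C : ℝ, 0 < C ∧ ∀ (B : ℕ) (e : ℤ),
    ∑ v ∈ Icc 1 B, ∑ u ∈ Icc 1 B,
        (max 1 ((((u : ℤ) - v + e).natAbs : ℝ) / Nat.totient ((u : ℤ) - v + e).natAbs)) ^ K ≤
      C * B * (2 * (B : ℝ) + |(e : ℝ)| + 1) := by
  obtain ⟨C, hC, h1⟩ := sum_weight_shift_le K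
  refine ⟨C, hC, fun B e => ?_⟩
  have hv : ∀ v ∈ Icc 1 B, ∑ u ∈ Icc 1 B,
      (max 1 ((((u : ℤ) - v + e).natAbs : ℝ) / Nat.totient ((u : ℤ) - v + e).natAbs)) ^ K ≤
      C * (2 * (B : ℝ) + |(e : ℝ)| + 1) := by
    intro v hv
    rw [Finset.mem_Icc] at hv
    have h2 := h1 B (e - v)
    have heq : ∀ u : ℕ, (u : ℤ) - v + e = (u : ℤ) + (e - v) := fun u => by ring
    simp_rw [heq]
    refine h2.trans (mul_le_mul_of_nonneg_left ?_ hC.le)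
    have hvB : ((v : ℤ) : ℝ) ≤ B := by exact_mod_cast hv.2
    have hv0 : (0 : ℝ) ≤ ((v : ℤ) : ℝ) := by exact_mod_cast (Int.natCast_nonneg v)
    have : |((e - v : ℤ) : ℝ)| ≤ |(e : ℝ)| + B := by
      push_cast
      calc |(e : ℝ) - ((v : ℤ) : ℝ)| ≤ |(e : ℝ)| + |((v : ℤ) : ℝ)| := abs_sub _ _
        _ = |(e : ℝ)| + ((v : ℤ) : ℝ) := by rw [abs_of_nonneg hv0]
        _ ≤ |(e : ℝ)| + B := by linarith
    linarith
  calc _ ≤ ∑ v ∈ Icc 1 B, C * (2 * (B : ℝ) + |(e : ℝ)| + 1) := Finset.sum_le_sum hv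
    _ = _ := by rw [Finset.sum_const, Nat.card_Icc, nsmul_eq_mul]; push_cast; ring


/-! ### Products of weights `≥ 1` against sums of powers -/

/-- `∏_{i ∈ s} yᵢ ≤ ∑_{i ∈ s} yᵢ^{#s}` when all `yᵢ ≥ 1` and `s ≠ ∅` (the product is at most
`(max yᵢ)^{#s}`); used in place of Hölder's inequality over the pairs of a tuple. [folklore] -/
theorem prod_le_sum_pow_card {ι : Type*} (s : Finset ι) (hs : s.Nonempty) (y : ι → ℝ)
    (hy : ∀ i ∈ s, 1 ≤ y i) : ∏ i ∈ s, y i ≤ ∑ i ∈ s, y i ^ #s := by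
  obtain ⟨i₀, hi₀, hmax⟩ := Finset.exists_max_image s y hs
  calc ∏ i ∈ s, y i ≤ ∏ _i ∈ s, y i₀ :=
        Finset.prod_le_prod (fun i hi => by linarith [hy i hi]) fun i hi => hmax i hi
    _ = y i₀ ^ #s := Finset.prod_const _
    _ ≤ ∑ i ∈ s, y i ^ #s :=
        Finset.single_le_sum (f := fun i => y i ^ #s)
          (fun i hi => pow_nonneg (by linarith [hy i hi]) _) hi₀

end LichtmanTeravainen2022

end Literature.NumberTheory.Sieve
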